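import Mathlib
import Summits.Ventures.HodgeRepro.PeriodCloserC7

/-!
# PeriodCloserC7Places — where the residual checks (E2)/(E3) live: the non-split places where signs can differ

Blind re-derivation cell `pub-hodge-repro`, seat night-2 (gen 0).  Target tree path
`lean/Summits/Ventures/HodgeRepro/PeriodCloserC7Places.lean`.  Continues `PeriodCloserC7.lean`; the concrete
place table for `E = ℚ(ζ₅, √(4+√5))` is `OcticCMPoint.lean`.

The residual finite checks of the endoscopic criterion (ROUTE.md §4 item 2 (9); ROUTE-B §9.9 (c)/(d)) are (E2),
TP1's local root-number condition, and (E3), the root-number form of N1, at the non-split finite places where some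
datum ramifies — the set `S₃`.  Two printed / route-derived facts localise them:

* at a SPLIT place every local root number is `1` (TP1-defs, arXiv:2402.16808 p0022:L13–14: «If `𝔼_K = 𝔼 × 𝔼`, then
  we define `ε_{𝔼_K/𝔼}(χ, ψ, δ) = 1`»; ROUTE.md §4 item 2 (9)(a): «at a split place … TP1's ω_v and ε_v are 1 by
  definition») — so (E3) at a split place is `1 · 1 = 1 · 1`, and TP1's condition (E2) there is `1 = 1`;
* at a non-split place where the extension and the four characters are UNRAMIFIED the four local signs coincide
  (ROUTE-B §9.9 (d): «the unramified conjugate-symplectic character of `K_v^×` is UNIQUE … the four signs coincide»,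
  on Kudla (3.29) + Prop 3.8 (i)) — so (E3) holds there automatically.

Hence (E3) for a datum is EQUIVALENT to (E3) at the places of `S₃`, and (E2) to (E2) at the non-split places
(`E3_iff_on_S3`, `E2_iff_nonsplit`).  For the octic point the table of `OcticCMPoint.lean` names `S₃`:
`{𝔭₁, 𝔭₂ | 5 (ramified), 𝔮 | 2 (inert)} ∪ {places where the chosen finite data ramify}`, every place above `11`
being split.  Nothing here says anything about the status of the Hodge conjecture for CM abelian varieties,
which is NOT proved.
-/

set_option autoImplicit false

noncomputable section

namespace Summit.Ventures.HodgeRepro.PeriodCloser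

open NumberField

variable {L : Type} [Field L] [NumberField L] [IsCMField L]

/-- (E3) at ONE place `v`: `ε_v(χ′_0) ε_v(χ′_1) = ε_v(χ′_2) ε_v(χ′_3)`. -/
def E3At (I : C7Face L) (v : I.Place) (d : I.Datum) : Prop :=
  I.localRootNumber v (I.chars d 0) * I.localRootNumber v (I.chars d 1) =
    I.localRootNumber v (I.chars d 2) * I.localRootNumber v (I.chars d 3)

/-- (E3) is the conjunction of its local clauses. -/
theorem E3_iff_forall (I : C7Face L) (d : I.Datum) : I.E3 d ↔ ∀ v, E3At I v d := Iff.rfl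

/-- **PRINTED — the local root number at a split place is `1`** (TP1-defs p0022:L13–14; ROUTE.md §4 item 2
(9)(a)). -/
def SplitRootNumberOne (I : C7Face L) : Prop :=
  ∀ (v : I.Place) (χ : I.HeckeChar), I.IsSplit v → I.localRootNumber v χ = 1

/-- **PRINTED — TP1's local condition at a split place is automatic** (TP1-defs p0010:L12–30: `ω_{K_j/k_j}` is
the trivial character when `K_j` is not a field; p0022:L13–14: `ε = 1`; so the condition reads `1 = 1`). -/
def SplitLocalRootCond (I : C7Face L) : Prop :=
  ∀ (i : Fin 2) (v : I.Place) (d : I.Datum), I.IsSplit v → I.LocalRootCond i v d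

/-- (E3) holds at a place where the four local signs coincide. -/
theorem E3At_of_eq (I : C7Face L) (v : I.Place) (d : I.Datum) (s : ℤˣ)
    (h : ∀ j : Fin 4, I.localRootNumber v (I.chars d j) = s) : E3At I v d := by
  unfold E3At
  rw [h 0, h 1, h 2, h 3]

/-- (E3) holds at a split place. -/
theorem E3At_of_split (I : C7Face L) (hS : SplitRootNumberOne I) (v : I.Place) (hv : I.IsSplit v)
    (d : I.Datum) : E3At I v d :=
  E3At_of_eq I v d 1 fun j => hS v (I.chars d j) hv

/-- **(E3) lives on `S₃`**: if the four local signs coincide at every non-split place outside a set `S₃` (the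
unramified non-split places, ROUTE-B §9.9 (d)), then (E3) for the datum is equivalent to (E3) at the places of
`S₃`. -/
theorem E3_iff_on_S3 (I : C7Face L) (hS : SplitRootNumberOne I) (S₃ : Set I.Place) (d : I.Datum)
    (hun : ∀ v, ¬ I.IsSplit v → v ∉ S₃ → ∃ s : ℤˣ, ∀ j : Fin 4, I.localRootNumber v (I.chars d j) = s) :
    I.E3 d ↔ ∀ v ∈ S₃, E3At I v d := by
  constructor
  · exact fun h v _ => h v
  · intro h v
    by_cases hv : I.IsSplit v
    · exact E3At_of_split I hS v hv d
    · by_cases hv3 : v ∈ S₃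
      · exact h v hv3
      · obtain ⟨s, hs⟩ := hun v hv hv3
        exact E3At_of_eq I v d s hs

/-- **(E2) lives on the non-split places**: TP1's condition is automatic at split places, so (E2) for the datum
is equivalent to (E2) at the non-split places. -/
theorem E2_iff_nonsplit (I : C7Face L) (hS : SplitLocalRootCond I) (d : I.Datum) :
    I.E2 d ↔ ∀ (i : Fin 2) (v : I.Place), ¬ I.IsSplit v → I.LocalRootCond i v d := by
  constructor
  · exact fun h i v _ => h i v
  · intro h i v
    by_cases hv : I.IsSplit v
    · exact hS i v d hv
    · exact h i v hv

/-! ### The stability twist at the places of `S₃` (ROUTE-B §9.9 (d)) -/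

/-- **(E3) at a place of `S₃` from the stability of Gauss sums** — the algebra of ROUTE-B §9.9 (d) / ROUTE.md §4
item 2 (9)(d): after twisting `χ_{W_β}` by a character `ρ` of large conductor, «`ε(s, χρ, ψ) = χ(c_ρ) · ε(s, ρ, ψ)`,
`c_ρ` depending on `(ρ, ψ)` only» (Deligne's stability in Kudla's normalisation, re-derived by the lead on (3.32)),
so all four local root numbers have the form `e_j = χ′_j(c_ρ) · ε(ρ)`, and `ε(χ′_0ρ)ε(χ′_1ρ) = ε(χ′_2ρ)ε(χ′_3ρ)` follows
from `(χ′_0χ′_1)(c_ρ) = (χ′_2χ′_3)(c_ρ)` — which is N2 evaluated at `c_ρ`.  Stated for any commutative monoid of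
values: `e_j = f_j · u` for all `j` and `f_0 f_1 = f_2 f_3` give `e_0 e_1 = e_2 e_3`. -/
theorem E3At_of_stability {M : Type} [CommMonoid M] (e f : Fin 4 → M) (u : M)
    (hstab : ∀ j, e j = f j * u) (hN2 : f 0 * f 1 = f 2 * f 3) : e 0 * e 1 = e 2 * e 3 := by
  rw [hstab 0, hstab 1, hstab 2, hstab 3, mul_mul_mul_comm, hN2, mul_mul_mul_comm]

end Summit.Ventures.HodgeRepro.PeriodCloser

end
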